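import Summits.AnomalousDissipation.AnomalousDissipation.Theorems.WazewskiBlockSubLaminarThreeDTrapAtOneViscosity
import Literature.Analysis.FunctionSpaces.TorusCalculusProofs
import Literature.Analysis.FunctionSpaces.TorusFourierCalculus

/-!
# Stub `stub_steadyTransfer` of the line `Sketch`
# (crux stmt-AnomalousDissipation-10353, `WazewskiBlock.UniformWorkFloorTrap`)

**Steady transfer.** A Galerkin steady state `U` of order `N` at viscosity `ν ≥ 0` with an `L²`
force `f` — a Galerkin mode annihilating the tested steady Galerkin equations
`∫ (⟪U, (U·∇)a⟫ + ν⟪U, Δa⟫ + ⟪f, a⟫) = 0` against every Galerkin mode `a` of order `N` — lying in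
the block `{kineticEnergy ≤ E} ∩ {(f, ·) ≥ ε₀}` is, as the CONSTANT curve `t ↦ U`, a global
Galerkin trajectory of order `N` (`Literature.Analysis.FluidPDE.Torus.IsGalerkinTrajectory`)
trapped in the block for all `t ≥ 0`.

The tree's `Theorems.isGalerkinTrajectory_const_of_steady`
(`Theorems/WazewskiBlockSubLaminarThreeDTrapAtOneViscosity.lean`) reduces this to the steady energy
equation `ν‖∇U‖² = (f, U)` (spectral `eGradNormSq`), which is the test `a := U`: the transport term
vanishes, `∫⟪U, (U·∇)U⟫ = 0` (`Torus.integral_inner_convect_self_eq_zero`), and Green's identity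
`∫⟪U, ΔU⟫ = -‖∇U‖²` (`Torus.integral_inner_laplacian_eq_neg_holds`,
`Torus.gradNormSq_eq_toReal_eGradNormSq_holds`). Mathematics: R. Temam, *Navier–Stokes Equations*
(1979), Ch. II §1, (1.29) (energy equation of stationary Galerkin solutions); folklore.

* `integral_inner_self_laplacian_eq_neg_toReal_eGradNormSq` — `∫⟪U, ΔU⟫ = -(eGradNormSq U).toReal`
  for smooth `U` (any dimension).
* `steady_energy_eq_of_tested_self` — the steady energy equation from the self-tested steady
  equation, `f ∈ L²`, `U` smooth and divergence free (any dimension).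
* `stub_steadyTransfer` — the registered stub signature (dimension `3`).
-/

noncomputable section

-- `Summit.<Summit>.<Problem>` is the tree's mandated summit-side namespace (CONVENTIONS §2); deliberate duplicate.
set_option linter.dupNamespace false

namespace Summit.AnomalousDissipation.AnomalousDissipation.Theorems.UniformWorkFloorTrap.Sketch

open scoped InnerProductSpace
open MeasureTheory Filter Set UnitAddTorus
open Literature.Analysis.FunctionSpaces Literature.Analysis.FunctionSpaces.Torus
open Literature.Analysis.FluidPDE

/-! ## The steady energy equation -/

/-- **Green's first identity, spectral form.** For a smooth real vector field `U` on `T^d`,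
`∫ ⟪U, ΔU⟫ = -‖∇U‖₂²` with the right-hand side measured by the spectral `eGradNormSq`
(`Torus.integral_inner_laplacian_eq_neg_holds`: `∫⟪U, ΔU⟫ = -∑ᵢ ∫‖∂ᵢU‖²`;
`Torus.gradNormSq_eq_toReal_eGradNormSq_holds`: `∫ ∑ᵢ ‖∂ᵢU‖² = (eGradNormSq U).toReal`).
[folklore] -/
theorem integral_inner_self_laplacian_eq_neg_toReal_eGradNormSq {d : Type*} [Fintype d]
    [DecidableEq d] {U : UnitAddTorus d → EuclideanSpace ℝ d} (hU : IsSmooth U) :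
    ∫ x, ⟪U x, laplacian U x⟫_ℝ = -(eGradNormSq U).toReal := by
  -- adapted from `TaylorGreenLoudGalerkinStates.GaugeBackward.energy_identity`
  have hint : ∀ i, Integrable (fun x => ‖partialDeriv i U x‖ ^ 2) volume := fun i =>
    ((hU.partialDeriv i).norm_sq).integrable
  rw [integral_inner_laplacian_eq_neg_holds hU, ← gradNormSq_eq_toReal_eGradNormSq_holds hU,
    gradNormSq, integral_finsetSum _ fun i _ => hint i]

/-- **The steady energy equation of a self-tested steady state.** If `f ∈ L²(T^d)` and the smooth
divergence-free field `U` satisfies the steady equation tested against itself,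
`∫ (⟪U, (U·∇)U⟫ + ν⟪U, ΔU⟫ + ⟪f, U⟫) = 0`, then `ν ‖∇U‖₂² = ∫ ⟪f, U⟫` (spectral `eGradNormSq`):
the three summands are integrable (`U` smooth, `⟪f, U⟫` by
`Torus.integrable_inner_of_memLp_of_isSmooth`), the transport term vanishes
(`Torus.integral_inner_convect_self_eq_zero`) and `∫⟪U, ΔU⟫ = -‖∇U‖₂²` (Temam 1979, Ch. II (1.29)).
[folklore] -/
theorem steady_energy_eq_of_tested_self {d : Type*} [Fintype d] [DecidableEq d] {ν : ℝ}
    {f U : UnitAddTorus d → EuclideanSpace ℝ d} (hf : MemLp f 2 volume) (hU : IsSmooth U)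
    (hdiv : IsDivFree U)
    (hsteady : ∫ x, (⟪U x, convect U U x⟫_ℝ + ν * ⟪U x, laplacian U x⟫_ℝ + ⟪f x, U x⟫_ℝ) = 0) :
    ν * (eGradNormSq U).toReal = ∫ x, ⟪f x, U x⟫_ℝ := by
  -- adapted from `MomentLadder.steady_energy_identity` (Theorems/MomentParityMomentLadderStubSteadyCorner.lean)
  have hi1 : Integrable (fun x => ⟪U x, convect U U x⟫_ℝ) volume :=
    (hU.inner (hU.convect hU)).integrable
  have hi2 : Integrable (fun x => ν * ⟪U x, laplacian U x⟫_ℝ) volume :=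
    ((hU.inner hU.laplacian).integrable).const_mul ν
  have hi3 : Integrable (fun x => ⟪f x, U x⟫_ℝ) volume :=
    Torus.integrable_inner_of_memLp_of_isSmooth hf hU
  have h1 : ∫ x, ⟪U x, convect U U x⟫_ℝ = 0 :=
    calc ∫ x, ⟪U x, convect U U x⟫_ℝ = ∫ x, ⟪convect U U x, U x⟫_ℝ :=
          integral_congr_ae (ae_of_all _ fun x => real_inner_comm _ _)
      _ = 0 := integral_inner_convect_self_eq_zero hU hdiv
  have hi12 : Integrable (fun x => ⟪U x, convect U U x⟫_ℝ + ν * ⟪U x, laplacian U x⟫_ℝ) volume :=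
    hi1.add hi2
  rw [integral_add hi12 hi3, integral_add hi1 hi2, integral_const_mul, h1, zero_add,
    integral_inner_self_laplacian_eq_neg_toReal_eGradNormSq hU] at hsteady
  linarith

/-! ## The stub -/

/-- **Steady transfer** (stub `stub_steadyTransfer` of line `Sketch`, crux
stmt-AnomalousDissipation-10353). A Galerkin steady state `U` of order `N` at viscosity `ν ≥ 0`
with the force `f ∈ L²` — a Galerkin mode annihilating the tested Galerkin equations against every
Galerkin mode of order `N` — lying in the block (`kineticEnergy U ≤ E`, `(f, U) ≥ ε₀`) yields a
global Galerkin trajectory of order `N` trapped in the block for all `t ≥ 0`: the constant curve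
`t ↦ U` (`Theorems.isGalerkinTrajectory_const_of_steady`, its steady energy equation supplied by
`steady_energy_eq_of_tested_self` with the test `a := U`). [folklore] -/
theorem stub_steadyTransfer :
    ∀ (ν : ℝ) (N : ℕ) (f U : UnitAddTorus (Fin 3) → EuclideanSpace ℝ (Fin 3)) (E ε₀ : ℝ), 0 ≤ ν →
      MemLp f 2 volume → IsGalerkinMode N U →
      (∀ a : UnitAddTorus (Fin 3) → EuclideanSpace ℝ (Fin 3), IsGalerkinMode N a →
        ∫ x, (⟪U x, convect U a x⟫_ℝ + ν * ⟪U x, laplacian a x⟫_ℝ + ⟪f x, a x⟫_ℝ) = 0) →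
      kineticEnergy U ≤ E → ε₀ ≤ ∫ x, ⟪f x, U x⟫_ℝ →
      ∃ V : ℝ → UnitAddTorus (Fin 3) → EuclideanSpace ℝ (Fin 3), Torus.IsGalerkinTrajectory ν f N V ∧
        ∀ t : ℝ, 0 ≤ t → kineticEnergy (V t) ≤ E ∧ ε₀ ≤ ∫ x, ⟪f x, V t x⟫_ℝ := by
  intro ν N f U E ε₀ _hν hf hU hsteady hE hW
  have henergy : ν * (eGradNormSq U).toReal = ∫ x, ⟪f x, U x⟫_ℝ :=
    steady_energy_eq_of_tested_self hf hU.isSmooth hU.isDivFree (hsteady U hU)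
  exact ⟨fun _ => U, isGalerkinTrajectory_const_of_steady hU hsteady henergy, fun _ _ => ⟨hE, hW⟩⟩

end Summit.AnomalousDissipation.AnomalousDissipation.Theorems.UniformWorkFloorTrap.Sketch

end
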